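import Summits.Ventures.PercRepro.Night2GeneralQPoly

/-!
# PercRepro — the polynomial target-sum inequality `PolyIneq q n` of the regime `(q − 1, q − 3)` for `6 ≤ n ≤ 14`
(night-2, gen 21)

For each `n` the inequality `2 ((q³ + 2q² + 9q + 12) − (2q + 3) n) C(n, 4) ≤ 2 (2q + 3)(n + q − 4) A(n) + q (q + 1)² (n + q − 4)(n + 1)`
is proved for every `q ≥ 4` in three ranges: for small `q` the `A`-term alone carries the left side (a concave
cubic in `q`, certified by `(q − 4)(Q_A − q)(2 C q + β) ≥ 0` and its chord), for large `q` the `T`-term alone does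
(the Horner chain `q⁴ ≥ Q_T q³ ≥ Q_T² q² ≥ …`), and the finitely many `q` in between are evaluated in the kernel
(`A(n)` and `C(n, 4)` as numerals, `decide`).  Constants and ranges from `mining/night-2/g21/regions21b.py`.
-/

namespace PercRepro.Shadow

open Finset PerFlat ThmH

/-- `PolyIneq q 6` for every `q ≥ 4` (`A(6) = 0`, `C(6, 4) = 15`; `A`-term alone for `q ≤ 3`, `T`-term alone for `q ≥ 4`). -/
theorem polyIneq_six {q : ℕ} (hq : 4 ≤ q) : PolyIneq q 6 := by
  have hA : DGen.Aρt 6 4 2 = 0 := by decide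
  have hC : Nat.choose 6 4 = 15 := by decide
  unfold PolyIneq
  rw [hA, hC]
  push_cast
  have hx4 : (4 : ℚ) ≤ (q : ℚ) := by exact_mod_cast hq
  have hnq : (0 : ℚ) ≤ 6 + (q : ℚ) - 4 := by linarith
  have hT : (0 : ℚ) ≤ (q : ℚ) * ((q : ℚ) + 1) ^ 2 * (6 + (q : ℚ) - 4) * (6 + 1) :=
    mul_nonneg (mul_nonneg (by positivity) hnq) (by norm_num)
  have hAt : (0 : ℚ) ≤ 2 * (2 * (q : ℚ) + 3) * (6 + (q : ℚ) - 4) * 0 :=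
    mul_nonneg (mul_nonneg (by linarith) hnq) (by norm_num)
  have hQ : (4 : ℚ) ≤ (q : ℚ) := by exact_mod_cast hq
  have h1 : (4 : ℚ) * (q : ℚ) ≤ (q : ℚ) ^ 2 := by nlinarith
  have h2 : (4 : ℚ) * (q : ℚ) ^ 2 ≤ (q : ℚ) ^ 3 := by nlinarith
  have h3 : (4 : ℚ) * (q : ℚ) ^ 3 ≤ (q : ℚ) ^ 4 := by nlinarith
  nlinarith [h1, h2, h3, hAt, hQ]

/-- `PolyIneq q 7` for every `q ≥ 4` (`A(7) = 21`, `C(7, 4) = 35`; `A`-term alone for `q ≤ 3`, `T`-term alone for `q ≥ 6`, kernel evaluation between). -/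
theorem polyIneq_seven {q : ℕ} (hq : 4 ≤ q) : PolyIneq q 7 := by
  have hA : DGen.Aρt 7 4 2 = 21 := by decide
  have hC : Nat.choose 7 4 = 35 := by decide
  unfold PolyIneq
  rw [hA, hC]
  push_cast
  have hx4 : (4 : ℚ) ≤ (q : ℚ) := by exact_mod_cast hq
  have hnq : (0 : ℚ) ≤ 7 + (q : ℚ) - 4 := by linarith
  have hT : (0 : ℚ) ≤ (q : ℚ) * ((q : ℚ) + 1) ^ 2 * (7 + (q : ℚ) - 4) * (7 + 1) :=
    mul_nonneg (mul_nonneg (by positivity) hnq) (by norm_num)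
  have hAt : (0 : ℚ) ≤ 2 * (2 * (q : ℚ) + 3) * (7 + (q : ℚ) - 4) * 21 :=
    mul_nonneg (mul_nonneg (by linarith) hnq) (by norm_num)
  rcases le_or_gt 6 q with hge | hmid
  · have hQ : (6 : ℚ) ≤ (q : ℚ) := by exact_mod_cast hge
    have h1 : (6 : ℚ) * (q : ℚ) ≤ (q : ℚ) ^ 2 := by nlinarith
    have h2 : (6 : ℚ) * (q : ℚ) ^ 2 ≤ (q : ℚ) ^ 3 := by nlinarith
    have h3 : (6 : ℚ) * (q : ℚ) ^ 3 ≤ (q : ℚ) ^ 4 := by nlinarith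
    nlinarith [h1, h2, h3, hAt, hQ]
  · interval_cases q <;> norm_num

/-- `PolyIneq q 8` for every `q ≥ 4` (`A(8) = 84`, `C(8, 4) = 70`; `A`-term alone for `q ≤ 5`, `T`-term alone for `q ≥ 12`, kernel evaluation between). -/
theorem polyIneq_eight {q : ℕ} (hq : 4 ≤ q) : PolyIneq q 8 := by
  have hA : DGen.Aρt 8 4 2 = 84 := by decide
  have hC : Nat.choose 8 4 = 70 := by decide
  unfold PolyIneq
  rw [hA, hC]
  push_cast
  have hx4 : (4 : ℚ) ≤ (q : ℚ) := by exact_mod_cast hq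
  have hnq : (0 : ℚ) ≤ 8 + (q : ℚ) - 4 := by linarith
  have hT : (0 : ℚ) ≤ (q : ℚ) * ((q : ℚ) + 1) ^ 2 * (8 + (q : ℚ) - 4) * (8 + 1) :=
    mul_nonneg (mul_nonneg (by positivity) hnq) (by norm_num)
  have hAt : (0 : ℚ) ≤ 2 * (2 * (q : ℚ) + 3) * (8 + (q : ℚ) - 4) * 84 :=
    mul_nonneg (mul_nonneg (by linarith) hnq) (by norm_num)
  rcases le_or_gt q 5 with hle | hlt
  · have hQ : (q : ℚ) ≤ 5 := by exact_mod_cast hle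
    have hlin : (0 : ℚ) ≤ 2 * 70 * (q : ℚ) + 1204 := by linarith
    nlinarith [mul_nonneg (mul_nonneg (sub_nonneg.2 hx4) (sub_nonneg.2 hQ)) hlin, hT, hx4, hQ]
  · rcases le_or_gt 12 q with hge | hmid
    · have hQ : (12 : ℚ) ≤ (q : ℚ) := by exact_mod_cast hge
      have h1 : (12 : ℚ) * (q : ℚ) ≤ (q : ℚ) ^ 2 := by nlinarith
      have h2 : (12 : ℚ) * (q : ℚ) ^ 2 ≤ (q : ℚ) ^ 3 := by nlinarith
      have h3 : (12 : ℚ) * (q : ℚ) ^ 3 ≤ (q : ℚ) ^ 4 := by nlinarith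
      nlinarith [h1, h2, h3, hAt, hQ]
    · interval_cases q <;> norm_num

/-- `PolyIneq q 9` for every `q ≥ 4` (`A(9) = 246`, `C(9, 4) = 126`; `A`-term alone for `q ≤ 7`, `T`-term alone for `q ≥ 21`, kernel evaluation between). -/
theorem polyIneq_nine {q : ℕ} (hq : 4 ≤ q) : PolyIneq q 9 := by
  have hA : DGen.Aρt 9 4 2 = 246 := by decide
  have hC : Nat.choose 9 4 = 126 := by decide
  unfold PolyIneq
  rw [hA, hC]
  push_cast
  have hx4 : (4 : ℚ) ≤ (q : ℚ) := by exact_mod_cast hq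
  have hnq : (0 : ℚ) ≤ 9 + (q : ℚ) - 4 := by linarith
  have hT : (0 : ℚ) ≤ (q : ℚ) * ((q : ℚ) + 1) ^ 2 * (9 + (q : ℚ) - 4) * (9 + 1) :=
    mul_nonneg (mul_nonneg (by positivity) hnq) (by norm_num)
  have hAt : (0 : ℚ) ≤ 2 * (2 * (q : ℚ) + 3) * (9 + (q : ℚ) - 4) * 246 :=
    mul_nonneg (mul_nonneg (by linarith) hnq) (by norm_num)
  rcases le_or_gt q 7 with hle | hlt
  · have hQ : (q : ℚ) ≤ 7 := by exact_mod_cast hle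
    have hlin : (0 : ℚ) ≤ 2 * 126 * (q : ℚ) + 2292 := by linarith
    nlinarith [mul_nonneg (mul_nonneg (sub_nonneg.2 hx4) (sub_nonneg.2 hQ)) hlin, hT, hx4, hQ]
  · rcases le_or_gt 21 q with hge | hmid
    · have hQ : (21 : ℚ) ≤ (q : ℚ) := by exact_mod_cast hge
      have h1 : (21 : ℚ) * (q : ℚ) ≤ (q : ℚ) ^ 2 := by nlinarith
      have h2 : (21 : ℚ) * (q : ℚ) ^ 2 ≤ (q : ℚ) ^ 3 := by nlinarith
      have h3 : (21 : ℚ) * (q : ℚ) ^ 3 ≤ (q : ℚ) ^ 4 := by nlinarith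
      nlinarith [h1, h2, h3, hAt, hQ]
    · interval_cases q <;> norm_num

/-- `PolyIneq q 10` for every `q ≥ 4` (`A(10) = 627`, `C(10, 4) = 210`; `A`-term alone for `q ≤ 10`, `T`-term alone for `q ≥ 33`, kernel evaluation between). -/
theorem polyIneq_ten {q : ℕ} (hq : 4 ≤ q) : PolyIneq q 10 := by
  have hA : DGen.Aρt 10 4 2 = 627 := by decide
  have hC : Nat.choose 10 4 = 210 := by decide
  unfold PolyIneq
  rw [hA, hC]
  push_cast
  have hx4 : (4 : ℚ) ≤ (q : ℚ) := by exact_mod_cast hq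
  have hnq : (0 : ℚ) ≤ 10 + (q : ℚ) - 4 := by linarith
  have hT : (0 : ℚ) ≤ (q : ℚ) * ((q : ℚ) + 1) ^ 2 * (10 + (q : ℚ) - 4) * (10 + 1) :=
    mul_nonneg (mul_nonneg (by positivity) hnq) (by norm_num)
  have hAt : (0 : ℚ) ≤ 2 * (2 * (q : ℚ) + 3) * (10 + (q : ℚ) - 4) * 627 :=
    mul_nonneg (mul_nonneg (by linarith) hnq) (by norm_num)
  rcases le_or_gt q 10 with hle | hlt
  · have hQ : (q : ℚ) ≤ 10 := by exact_mod_cast hle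
    have hlin : (0 : ℚ) ≤ 2 * 210 * (q : ℚ) + 4212 := by linarith
    nlinarith [mul_nonneg (mul_nonneg (sub_nonneg.2 hx4) (sub_nonneg.2 hQ)) hlin, hT, hx4, hQ]
  · rcases le_or_gt 33 q with hge | hmid
    · have hQ : (33 : ℚ) ≤ (q : ℚ) := by exact_mod_cast hge
      have h1 : (33 : ℚ) * (q : ℚ) ≤ (q : ℚ) ^ 2 := by nlinarith
      have h2 : (33 : ℚ) * (q : ℚ) ^ 2 ≤ (q : ℚ) ^ 3 := by nlinarith
      have h3 : (33 : ℚ) * (q : ℚ) ^ 3 ≤ (q : ℚ) ^ 4 := by nlinarith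
      nlinarith [h1, h2, h3, hAt, hQ]
    · interval_cases q <;> norm_num

/-- `PolyIneq q 11` for every `q ≥ 4` (`A(11) = 1474`, `C(11, 4) = 330`; `A`-term alone for `q ≤ 13`, `T`-term alone for `q ≥ 48`, kernel evaluation between). -/
theorem polyIneq_eleven {q : ℕ} (hq : 4 ≤ q) : PolyIneq q 11 := by
  have hA : DGen.Aρt 11 4 2 = 1474 := by decide
  have hC : Nat.choose 11 4 = 330 := by decide
  unfold PolyIneq
  rw [hA, hC]
  push_cast
  have hx4 : (4 : ℚ) ≤ (q : ℚ) := by exact_mod_cast hq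
  have hnq : (0 : ℚ) ≤ 11 + (q : ℚ) - 4 := by linarith
  have hT : (0 : ℚ) ≤ (q : ℚ) * ((q : ℚ) + 1) ^ 2 * (11 + (q : ℚ) - 4) * (11 + 1) :=
    mul_nonneg (mul_nonneg (by positivity) hnq) (by norm_num)
  have hAt : (0 : ℚ) ≤ 2 * (2 * (q : ℚ) + 3) * (11 + (q : ℚ) - 4) * 1474 :=
    mul_nonneg (mul_nonneg (by linarith) hnq) (by norm_num)
  rcases le_or_gt q 13 with hle | hlt
  · have hQ : (q : ℚ) ≤ 13 := by exact_mod_cast hle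
    have hlin : (0 : ℚ) ≤ 2 * 330 * (q : ℚ) + 6644 := by linarith
    nlinarith [mul_nonneg (mul_nonneg (sub_nonneg.2 hx4) (sub_nonneg.2 hQ)) hlin, hT, hx4, hQ]
  · rcases le_or_gt 48 q with hge | hmid
    · have hQ : (48 : ℚ) ≤ (q : ℚ) := by exact_mod_cast hge
      have h1 : (48 : ℚ) * (q : ℚ) ≤ (q : ℚ) ^ 2 := by nlinarith
      have h2 : (48 : ℚ) * (q : ℚ) ^ 2 ≤ (q : ℚ) ^ 3 := by nlinarith
      have h3 : (48 : ℚ) * (q : ℚ) ^ 3 ≤ (q : ℚ) ^ 4 := by nlinarith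
      nlinarith [h1, h2, h3, hAt, hQ]
    · interval_cases q <;> norm_num

/-- `PolyIneq q 12` for every `q ≥ 4` (`A(12) = 3289`, `C(12, 4) = 495`; `A`-term alone for `q ≤ 19`, `T`-term alone for `q ≥ 69`, kernel evaluation between). -/
theorem polyIneq_twelve {q : ℕ} (hq : 4 ≤ q) : PolyIneq q 12 := by
  have hA : DGen.Aρt 12 4 2 = 3289 := by decide
  have hC : Nat.choose 12 4 = 495 := by decide
  unfold PolyIneq
  rw [hA, hC]
  push_cast
  have hx4 : (4 : ℚ) ≤ (q : ℚ) := by exact_mod_cast hq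
  have hnq : (0 : ℚ) ≤ 12 + (q : ℚ) - 4 := by linarith
  have hT : (0 : ℚ) ≤ (q : ℚ) * ((q : ℚ) + 1) ^ 2 * (12 + (q : ℚ) - 4) * (12 + 1) :=
    mul_nonneg (mul_nonneg (by positivity) hnq) (by norm_num)
  have hAt : (0 : ℚ) ≤ 2 * (2 * (q : ℚ) + 3) * (12 + (q : ℚ) - 4) * 3289 :=
    mul_nonneg (mul_nonneg (by linarith) hnq) (by norm_num)
  rcases le_or_gt q 19 with hle | hlt
  · have hQ : (q : ℚ) ≤ 19 := by exact_mod_cast hle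
    have hlin : (0 : ℚ) ≤ 2 * 495 * (q : ℚ) + 11594 := by linarith
    nlinarith [mul_nonneg (mul_nonneg (sub_nonneg.2 hx4) (sub_nonneg.2 hQ)) hlin, hT, hx4, hQ]
  · rcases le_or_gt 69 q with hge | hmid
    · have hQ : (69 : ℚ) ≤ (q : ℚ) := by exact_mod_cast hge
      have h1 : (69 : ℚ) * (q : ℚ) ≤ (q : ℚ) ^ 2 := by nlinarith
      have h2 : (69 : ℚ) * (q : ℚ) ^ 2 ≤ (q : ℚ) ^ 3 := by nlinarith
      have h3 : (69 : ℚ) * (q : ℚ) ^ 3 ≤ (q : ℚ) ^ 4 := by nlinarith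
      nlinarith [h1, h2, h3, hAt, hQ]
    · interval_cases q <;> norm_num

/-- `PolyIneq q 13` for every `q ≥ 4` (`A(13) = 7085`, `C(13, 4) = 715`; `A`-term alone for `q ≤ 26`, `T`-term alone for `q ≥ 94`, kernel evaluation between). -/
theorem polyIneq_thirteen {q : ℕ} (hq : 4 ≤ q) : PolyIneq q 13 := by
  have hA : DGen.Aρt 13 4 2 = 7085 := by decide
  have hC : Nat.choose 13 4 = 715 := by decide
  unfold PolyIneq
  rw [hA, hC]
  push_cast
  have hx4 : (4 : ℚ) ≤ (q : ℚ) := by exact_mod_cast hq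
  have hnq : (0 : ℚ) ≤ 13 + (q : ℚ) - 4 := by linarith
  have hT : (0 : ℚ) ≤ (q : ℚ) * ((q : ℚ) + 1) ^ 2 * (13 + (q : ℚ) - 4) * (13 + 1) :=
    mul_nonneg (mul_nonneg (by positivity) hnq) (by norm_num)
  have hAt : (0 : ℚ) ≤ 2 * (2 * (q : ℚ) + 3) * (13 + (q : ℚ) - 4) * 7085 :=
    mul_nonneg (mul_nonneg (by linarith) hnq) (by norm_num)
  rcases le_or_gt q 26 with hle | hlt
  · have hQ : (q : ℚ) ≤ 26 := by exact_mod_cast hle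
    have hlin : (0 : ℚ) ≤ 2 * 715 * (q : ℚ) + 17420 := by linarith
    nlinarith [mul_nonneg (mul_nonneg (sub_nonneg.2 hx4) (sub_nonneg.2 hQ)) hlin, hT, hx4, hQ]
  · rcases le_or_gt 94 q with hge | hmid
    · have hQ : (94 : ℚ) ≤ (q : ℚ) := by exact_mod_cast hge
      have h1 : (94 : ℚ) * (q : ℚ) ≤ (q : ℚ) ^ 2 := by nlinarith
      have h2 : (94 : ℚ) * (q : ℚ) ^ 2 ≤ (q : ℚ) ^ 3 := by nlinarith
      have h3 : (94 : ℚ) * (q : ℚ) ^ 3 ≤ (q : ℚ) ^ 4 := by nlinarith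
      nlinarith [h1, h2, h3, hAt, hQ]
    · interval_cases q <;> norm_num

/-- `PolyIneq q 14` for every `q ≥ 4` (`A(14) = 14898`, `C(14, 4) = 1001`; `A`-term alone for `q ≤ 37`, `T`-term alone for `q ≥ 124`, kernel evaluation between). -/
theorem polyIneq_fourteen {q : ℕ} (hq : 4 ≤ q) : PolyIneq q 14 := by
  have hA : DGen.Aρt 14 4 2 = 14898 := by decide
  have hC : Nat.choose 14 4 = 1001 := by decide
  unfold PolyIneq
  rw [hA, hC]
  push_cast
  have hx4 : (4 : ℚ) ≤ (q : ℚ) := by exact_mod_cast hq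
  have hnq : (0 : ℚ) ≤ 14 + (q : ℚ) - 4 := by linarith
  have hT : (0 : ℚ) ≤ (q : ℚ) * ((q : ℚ) + 1) ^ 2 * (14 + (q : ℚ) - 4) * (14 + 1) :=
    mul_nonneg (mul_nonneg (by positivity) hnq) (by norm_num)
  have hAt : (0 : ℚ) ≤ 2 * (2 * (q : ℚ) + 3) * (14 + (q : ℚ) - 4) * 14898 :=
    mul_nonneg (mul_nonneg (by linarith) hnq) (by norm_num)
  rcases le_or_gt q 37 with hle | hlt
  · have hQ : (q : ℚ) ≤ 37 := by exact_mod_cast hle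
    have hlin : (0 : ℚ) ≤ 2 * 1001 * (q : ℚ) + 26494 := by linarith
    nlinarith [mul_nonneg (mul_nonneg (sub_nonneg.2 hx4) (sub_nonneg.2 hQ)) hlin, hT, hx4, hQ]
  · rcases le_or_gt 124 q with hge | hmid
    · have hQ : (124 : ℚ) ≤ (q : ℚ) := by exact_mod_cast hge
      have h1 : (124 : ℚ) * (q : ℚ) ≤ (q : ℚ) ^ 2 := by nlinarith
      have h2 : (124 : ℚ) * (q : ℚ) ^ 2 ≤ (q : ℚ) ^ 3 := by nlinarith
      have h3 : (124 : ℚ) * (q : ℚ) ^ 3 ≤ (q : ℚ) ^ 4 := by nlinarith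
      nlinarith [h1, h2, h3, hAt, hQ]
    · interval_cases q <;> norm_num

end PercRepro.Shadow

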